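import Summits.BirchSwinnertonDyer.BirchSwinnertonDyer.Theorems.CyclotomicUntwistPrimePowerGaussSum
import Literature.NumberTheory.EllipticCurves.PAdicLFunctionNeZeroHoldsProofs
import Literature.NumberTheory.EllipticCurves.ModularSymbolsHeckeProofs
import HarnessLib

/-!
# The untwisted `p`-adic `L`-function of D1 is NOT identically zero, given Rohrlich-type
# non-vanishing of the twisted values at `p`-power conductors; Gauss sums over `ℤ/p^c`

Cell `pub/bsd-wall` (D-0145 line `route-BirchSwinnertonDyer-CyclotomicUntwist`), seat `bsd-line-cycu-p1`
(prover seat 1/3, K1 base), helper toward crux K1 `PSRankOneLowerHalfAtThree`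
(stmt-BirchSwinnertonDyer-21580). THEOREMS ONLY (no definition, no named fact, no `sorry`); BSD is not
proved by this file and no crux is.

Companion of `CyclotomicUntwistUntwistingIdentity` (the untwisting identity (★):
`untwistSymbolSum p f η χ = η(−1) · g(η, ψ_χ) · ratTwistedSymbolSum f (χ η↑)` at conductor `pⁿ ≥ p^{2c}`).
The two non-degeneracy inputs of (★) are proved in the companion `CyclotomicUntwistPrimePowerGaussSum`
(§1–§2 below summarise it) and here the identity is run against the tree's
`ℚ̄ ↔ ℂ / ℂ_p` transport of twisted symbol sums (`PAdicLFunctionProofs`), exactly as the tree does for the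
good ordinary `L_p(E,T) ≠ 0` (`padicLFunction_ne_zero_of_rohrlich`):

* §1 **Gauss sums over the non-field `ℤ/p^c`**: for `η` PRIMITIVE mod `p^c` (`c ≥ 1`) and any additive
  `ψ`, the shifted sums `g(η, ψ(a·)) = 0` at NON-units `a` (`gaussSum_mulShift_eq_zero_of_not_isUnit`:
  primitivity gives `u ≡ 1 (p^{c−1})` with `η(u) ≠ 1` and `au = a`); hence for `ψ` PRIMITIVE the product
  formula `g(η, ψ) · g(η̄, ψ̄) = p^c` (`gaussSum_mul_gaussSum_inv_eq`, by summing `g(η,ψ_a)g(η̄,ψ̄_a)` over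
  all `a` and orthogonality `∑_a ψ(ab) = p^c·[b = 0]`) and `g(η, ψ) ≠ 0` (`gaussSum_ne_zero_of_isPrimitive`).
  Mathlib's `gaussSum_mul_gaussSum_eq_card` needs the domain to be a FIELD, which `ℤ/9` is not.
* §2 **Primitivity**: an additive character of `ℤ/p^c` non-trivial at `p^{c−1}` is primitive
  (`addChar_isPrimitive_of_apply_ne_one`); a primitive `χ` mod `pⁿ`, `n ≥ 2`, has `χ(1 + p^{n−1}) ≠ 1`
  (`apply_one_add_pow_ne_one`); so `ψ_χ : y ↦ χ(1 + p^{n−c}y)` is primitive (`isPrimitive_of_eq_untwistAddChar`);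
  and `χ := η̄↑ · ξ` is primitive of conductor `pⁿ` when `ξ` is and `c < n` (`isPrimitive_inv_changeLevel_mul`),
  with D1's compatibility clause (`inv_changeLevel_mul_apply_natCast`).
* §3 **`𝓛^η ≢ 0`** (`exists_apply_ne_zero_of_rohrlich`): if `μ` has the D1 property
  `IsUntwistedPAdicLFunction p f η α μ` for a rational newform `f` (`IsNewform0 f`, `coeffField f = ⊥`),
  `η` primitive mod `p^c` (`c ≥ 1`), `α ≠ 0`, and — HYPOTHESIS `hR`, the shape of the tree's
  `Rohrlich1984_nonvanishing_twists.primePow` but WITHOUT `p ∤ N` — only finitely many primitive Dirichlet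
  characters of `p`-power conductor have `L(f, χ, 1) = 0`, then `μ n s ≠ 0` for some ball: otherwise every
  `∫_Γ ξ dμ` vanishes, (★) + §1–§2 + `α ≠ 0` kill `∑ ξ(a)[a/pⁿ]⁺_f` in `ℂ_p` for every wild `ξ` of conductor
  `pⁿ ≥ p^{2c}` coming from `ℚ̄` (`exists_isPrimitive_even_orderOf_eq_prime_pow`), transport to `ℂ` and
  Birch's formula (`ratTwistedSymbolSum_mul_plusPeriod_holds`, `τ(ξ) ≠ 0`) give `L(f, ξ̄, 1) = 0` for
  infinitely many `ξ̄` — contradiction. For the route (`p = 3 ∣ N`, additive) `hR` is Rohrlich's 1989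
  theorem (Invent. Math. 97, twists ramified AT the level allowed), not the 1984 one typed in the tree
  (`Rohrlich1984_nonvanishing_twists` demands `p ∤ N`); it is carried as a hypothesis, not stated as a fact.

References: [cite: MazurTateTeitelbaum1986Invent, §I.8 (8.6), §I.14]; D. E. Rohrlich, *Nonvanishing of
L-functions for GL(2)*, Invent. Math. 97 (1989) 381–403 (source of `hR` when `p ∣ N`; hypothesis here);
Gauss sums mod `p^c` [folklore].
-/

noncomputable section

open scoped MatrixGroups

open CongruenceSubgroup DirichletCharacter Literature.NumberTheory.EllipticCurves
  Literature.NumberTheory.EllipticCurves.ModularForms Literature.NumberTheory.IwasawaTheory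
  Summit.BirchSwinnertonDyer.BirchSwinnertonDyer.Theorems.PSUntwisting
  Summit.BirchSwinnertonDyer.BirchSwinnertonDyer.Theorems.PSPrimePowerGauss

-- single-conjunct summit: `Summit.BirchSwinnertonDyer.BirchSwinnertonDyer.…` repeats the name by design
set_option linter.dupNamespace false
set_option autoImplicit false

namespace Summit.BirchSwinnertonDyer.BirchSwinnertonDyer.Theorems.PSUntwistNonvanishing

variable {p : ℕ} [Fact p.Prime]
/-! ### §3 `𝓛^η ≢ 0` from Rohrlich-type non-vanishing -/

section Nonvanishing

variable {N : ℕ} [NeZero N] {f : CuspForm (Gamma0 N) 2}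
variable {c : ℕ} {η : DirichletCharacter ℂ_[p] (p ^ c)} {α : ℂ_[p]} {μ : (n : ℕ) → ZMod (p ^ n) → ℂ_[p]}

/-- **If `μ ≡ 0` then every wild twisted symbol sum of conductor `pⁿ ≥ p^{2c}` vanishes in `ℂ_p`.**
For `μ` with the D1 property, `η` primitive mod `p^c` (`c ≥ 1`), `α ≠ 0`: if all ball values of `μ`
vanish then `∑_{a mod pⁿ} ξ(a)[a/pⁿ]⁺_f = 0` for every primitive even `ξ` mod `pⁿ` of `p`-power order,
`n ≥ 2c` — by the untwisting identity at `χ := η̄↑·ξ` (primitive, `isPrimitive_inv_changeLevel_mul`),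
whose multiplier `e_n(α) = α^{-n}`, sign `η(−1)` and Gauss sum `g(η, ψ_χ)` (§1–§2) are all non-zero.
[cite: MazurTateTeitelbaum1986Invent, §I.14 (case p ∣ N)] -/
theorem ratTwistedSymbolSum_eq_zero_of_forall_eq_zero (hμ : IsUntwistedPAdicLFunction p f η α μ)
    (hc : 0 < c) (hη : η.IsPrimitive) (hα : α ≠ 0) (h0 : ∀ (n : ℕ) (s : ZMod (p ^ n)), μ n s = 0)
    {n : ℕ} (hn : 2 * c ≤ n) (ξ : DirichletCharacter ℂ_[p] (p ^ n)) (hξ : ξ.IsPrimitive) (hξe : ξ.Even)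
    (hξo : ∃ j : ℕ, orderOf ξ = p ^ j) : ratTwistedSymbolSum f ξ = 0 := by
  have hcn : c < n := by omega
  set χ := changeLevel (pow_dvd_pow p hcn.le) η⁻¹ * ξ with hχ
  have hχprim : χ.IsPrimitive := isPrimitive_inv_changeLevel_mul η hcn ξ hξ
  have hcompat : ∀ a : ℕ, a.Coprime p →
      χ (a : ZMod (p ^ n)) = (η (a : ZMod (p ^ c)))⁻¹ * ξ (a : ZMod (p ^ n)) :=
    fun a ha ↦ inv_changeLevel_mul_apply_natCast η hc hcn.le ξ a ha
  obtain ⟨ψ, hψ⟩ := exists_addChar_eq χ hcn.le hn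
  have hval := gammaCharValue_eq_of_conductor_ge hμ hc hn ξ hξ hξe hξo χ hχprim hcompat ψ hψ
  have hlhs : gammaCharValue p μ ξ = 0 := by
    rw [gammaCharValue_def]
    exact Finset.sum_eq_zero fun s _ ↦ by rw [h0, mul_zero]
  rw [hlhs] at hval
  have he : untwistMultiplier p α n ≠ 0 := by
    obtain ⟨m, rfl⟩ : ∃ m, n = m + 1 := ⟨n - 1, by omega⟩
    rw [untwistMultiplier_succ]
    exact pow_ne_zero _ (inv_ne_zero hα)
  have hη1 : η (-1) ≠ 0 := by
    have h : η (-1) * η (-1) = 1 := by rw [← map_mul, neg_mul_neg, one_mul, map_one]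
    intro h'
    rw [h', zero_mul] at h
    exact zero_ne_one h
  have hG : gaussSum η ψ ≠ 0 :=
    gaussSum_ne_zero_of_isPrimitive η hc hη (isPrimitive_of_eq_untwistAddChar hc hn χ hχprim ψ hψ)
  rcases mul_eq_zero.mp hval.symm with h | h
  · exact absurd h he
  rcases mul_eq_zero.mp h with h' | h'
  · rcases mul_eq_zero.mp h' with h'' | h''
    · exact absurd h'' hη1
    · exact absurd h'' hG
  · exact h'

/-- **The untwisted `p`-adic `L`-function is not identically zero** (given Rohrlich-type non-vanishing).
Let `f ∈ S₂(Γ₀(N))` be a normalised newform with rational coefficients, `η` a PRIMITIVE Dirichlet character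
mod `p^c` (`c ≥ 1`), `α ≠ 0`, and `μ` ball values with the D1 property `IsUntwistedPAdicLFunction p f η α μ`.
HYPOTHESIS `hR` (the shape of the tree's `Rohrlich1984_nonvanishing_twists.primePow`, here WITHOUT `p ∤ N`;
for `p ∣ N` its source is Rohrlich, Invent. Math. 97 (1989), not typed in the tree): only finitely many
primitive Dirichlet characters of `p`-power conductor have `L(f, χ, 1) = 0`. THEN some ball value of `μ`
is non-zero. Proof: otherwise `ratTwistedSymbolSum_eq_zero_of_forall_eq_zero` kills the symbol sums of all
wild characters of conductor `p^{k+2c+3}` transported from `ℚ̄` (`exists_isPrimitive_even_orderOf_eq_prime_pow`);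
transporting to `ℂ` (`ratTwistedSymbolSum_ringHomComp`) and Birch's formula
(`ratTwistedSymbolSum_mul_plusPeriod_holds`, with `τ(ξ) ≠ 0` and the continuation
`exists_differentiable_eq_twistedLSeries_holds`) give `L(f, ξ̄_k, 1) = 0` for infinitely many `k`.
[cite: MazurTateTeitelbaum1986Invent, §I.14 (case p ∣ N)] -/
theorem exists_apply_ne_zero_of_rohrlich (hμ : IsUntwistedPAdicLFunction p f η α μ) (hc : 0 < c)
    (hη : η.IsPrimitive) (hα : α ≠ 0) (hf : IsNewform0 f) (hQ : coeffField f = ⊥)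
    (hR : Set.Finite {χ : Σ m : ℕ, DirichletCharacter ℂ m |
      χ.1 ≠ 0 ∧ χ.1.primeFactors ⊆ {p} ∧ χ.2.IsPrimitive ∧
        ∃ L : ℂ → ℂ, Differentiable ℂ L ∧
          (∀ s : ℂ, 2 < s.re → L s = twistedLSeries f χ.2 s) ∧ L 1 = 0}) :
    ∃ (n : ℕ) (s : ZMod (p ^ n)), μ n s ≠ 0 := by
  by_contra h0
  push Not at h0
  have hp : p.Prime := Fact.out
  -- characters over `ℚ̄`, embedded into `ℂ` and `ℂ_p`
  let K := AlgebraicClosure ℚ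
  let σ : K →+* ℂ := (@IsAlgClosed.lift ℂ _ _ ℚ _ _ K _ _ (AlgebraicClosure.instAlgebra ℚ) _ _ _
    (AlgebraicClosure.isAlgebraic ℚ)).toRingHom
  let τ : K →+* ℂ_[p] := (@IsAlgClosed.lift ℂ_[p] _ _ ℚ _ _ K _ _
    (AlgebraicClosure.instAlgebra ℚ) _ _ _ (AlgebraicClosure.isAlgebraic ℚ)).toRingHom
  have hψK : ∀ k : ℕ, ∃ ψ : DirichletCharacter K (p ^ (k + 2 * c + 3)),
      ψ.IsPrimitive ∧ ψ.Even ∧ ∃ j : ℕ, orderOf ψ = p ^ j := fun k ↦ by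
    haveI : NeZero ((Nat.totient (p ^ (k + 2 * c + 3)) : ℕ) : ℚ) :=
      ⟨Nat.cast_ne_zero.mpr (Nat.totient_pos.mpr (pow_pos hp.pos _)).ne'⟩
    exact exists_isPrimitive_even_orderOf_eq_prime_pow K (k + 2 * c)
  choose ψ hψprim hψeven hψord using hψK
  -- over `ℂ`, `L(f, (σψ_k)⁻¹, 1) = 0` for every `k`
  have hbad : ∀ k : ℕ, (⟨p ^ (k + 2 * c + 3), ((ψ k).ringHomComp σ)⁻¹⟩ : Σ m : ℕ, DirichletCharacter ℂ m) ∈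
      {χ : Σ m : ℕ, DirichletCharacter ℂ m |
        χ.1 ≠ 0 ∧ χ.1.primeFactors ⊆ {p} ∧ χ.2.IsPrimitive ∧
          ∃ L : ℂ → ℂ, Differentiable ℂ L ∧
            (∀ s : ℂ, 2 < s.re → L s = twistedLSeries f χ.2 s) ∧ L 1 = 0} := by
    intro k
    haveI : NeZero (p ^ (k + 2 * c + 3)) := ⟨pow_ne_zero _ hp.ne_zero⟩
    have hprimC : DirichletCharacter.IsPrimitive ((ψ k).ringHomComp σ) :=
      (isPrimitive_ringHomComp_iff σ (ψ k)).mpr (hψprim k)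
    refine ⟨pow_ne_zero _ hp.ne_zero, (Nat.primeFactors_prime_pow (by omega) hp).le, ?_, ?_⟩
    · rw [DirichletCharacter.isPrimitive_def, DirichletCharacter.conductor_inv]
      exact hprimC
    obtain ⟨L, hLd, hL⟩ := exists_differentiable_eq_twistedLSeries_holds f ((ψ k).ringHomComp σ)⁻¹
    refine ⟨L, hLd, hL, ?_⟩
    -- Birch: `(∑ ξ(a)[a/m]⁺) Ω⁺ = τ(ξ) L(f, ξ⁻¹, 1)` with `ξ = σψ_k`
    have hBirch := ratTwistedSymbolSum_mul_plusPeriod_holds (f := f) hf hQ hprimC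
      ((even_ringHomComp_iff σ (ψ k)).mpr (hψeven k)) hLd hL
    -- the left-hand side vanishes: transport `ℂ ← ℚ̄ → ℂ_p` and the previous theorem
    have hzero : ratTwistedSymbolSum f ((ψ k).ringHomComp σ) = 0 := by
      have hτ : ratTwistedSymbolSum f ((ψ k).ringHomComp τ) = 0 :=
        ratTwistedSymbolSum_eq_zero_of_forall_eq_zero hμ hc hη hα h0 (by omega) _
          ((isPrimitive_ringHomComp_iff τ (ψ k)).mpr (hψprim k))
          ((even_ringHomComp_iff τ (ψ k)).mpr (hψeven k))
          (by rw [orderOf_ringHomComp]; exact hψord k)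
      rw [ratTwistedSymbolSum_ringHomComp, map_eq_zero] at hτ
      rw [ratTwistedSymbolSum_ringHomComp, hτ, map_zero]
    rw [hzero, zero_mul, eq_comm, mul_eq_zero] at hBirch
    exact hBirch.resolve_left (gaussSum_stdAddChar_ne_zero hprimC)
  -- infinitely many distinct exceptional characters: contradiction
  let F : ℕ → Σ m : ℕ, DirichletCharacter ℂ m :=
    fun k ↦ ⟨p ^ (k + 2 * c + 3), ((ψ k).ringHomComp σ)⁻¹⟩
  have hFinj : Function.Injective F := fun k l h ↦ by
    have h1 : p ^ (k + 2 * c + 3) = p ^ (l + 2 * c + 3) := congr_arg Sigma.fst h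
    have := Nat.pow_right_injective hp.two_le h1
    omega
  have hfin : (Set.univ : Set ℕ).Finite := by
    refine (hR.preimage hFinj.injOn).subset fun k _ ↦ ?_
    exact hbad k
  exact Set.infinite_univ hfin

/-- The same for the route's D1 predicate over a Weierstrass curve (`p = 3`, `c = 2`): if
`IsPSCyclotomicLFunctionOf W η α μ` with `η` primitive mod `9` and `α ≠ 0`, and for the newform `f` of `W`
only finitely many primitive characters of `3`-power conductor have `L(f, χ, 1) = 0` (Rohrlich 1989 —
hypothesis, for EVERY level-`N` rational newform to keep the statement free of the existential `f`), then
`𝓛^η_W` has a non-zero ball value. [cite: MazurTateTeitelbaum1986Invent, §I.14 (case p ∣ N)] -/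
theorem exists_apply_ne_zero_of_isPSCyclotomicLFunctionOf {W : WeierstrassCurve ℚ}
    {η : DirichletCharacter ℂ_[3] (3 ^ 2)} {α : ℂ_[3]} {μ : (n : ℕ) → ZMod (3 ^ n) → ℂ_[3]}
    (hμ : IsPSCyclotomicLFunctionOf W η α μ) (hη : η.IsPrimitive) (hα : α ≠ 0)
    (hR : ∀ {N : ℕ} [NeZero N] (f : CuspForm (Gamma0 N) 2), IsNewformOf W f →
      Set.Finite {χ : Σ m : ℕ, DirichletCharacter ℂ m |
        χ.1 ≠ 0 ∧ χ.1.primeFactors ⊆ {3} ∧ χ.2.IsPrimitive ∧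
          ∃ L : ℂ → ℂ, Differentiable ℂ L ∧
            (∀ s : ℂ, 2 < s.re → L s = twistedLSeries f χ.2 s) ∧ L 1 = 0}) :
    ∃ (n : ℕ) (s : ZMod (3 ^ n)), μ n s ≠ 0 := by
  obtain ⟨N, hN, f, hf, hμf⟩ := hμ
  exact exists_apply_ne_zero_of_rohrlich hμf (by norm_num) hη hα hf.1 hf.coeffField_eq_bot (hR f hf)

end Nonvanishing

end Summit.BirchSwinnertonDyer.BirchSwinnertonDyer.Theorems.PSUntwistNonvanishing
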